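/-
Copyright (c) 2026 the pub-hodgecm-mathlib formalisation cell (harness21).  Prover seat hodgecm-mathlib-K2E5-p17 (g7), Track B «K2-LIT» ∕ h413
(`stmt-HodgeConjecture-24833`), line `K2_E3_EllipticInputs`, leaf (nsc-S-A′), brick GEO-QB (dealer D92∕D95; architect K2E3-p25 (g2) MEMO-SA-architecture v2 §3;
hand-off plan K2E3-p21 (g6) `MEMO-GEOQB-handoff.v1`), part (G3c) — THE HEAD.  2026-09-04.
-/
import Summits.HodgeConjecture.HodgeConjecture.Theorems.K2E3GL3StandardModuleJacquetLines    -- ★ GEO-QB (G3b) (this seat): the lines of the cells `s₂`, `s₁s₂`; brings (G3a), (G2), E3β, STD-EMB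
import Summits.HodgeConjecture.HodgeConjecture.Theorems.K2E3GL3PrincipalSeriesExponents      -- ★ H0-a (K2E3-p25): `tch_leviProjection_permGL_conj`; brings ★ E3δ (`perm_fin_three_cases`) and ★ E3α
import HarnessLib

/-!
# K2_E3 road (h413), leaf (nsc-S-A′), brick GEO-QB (G3c) — THE GEOMETRIC LEMMA FOR `(Q, B)` IN `GL₃`: the exponents of the standard module `D(η,ψ) = Ind_Q((η∘det₂ ⊠ ψ)δ_Q^{1∕2})`
# are `tch(ην½⁻¹, ην½, ψ)`, `tch(ην½⁻¹, ψ, ην½)`, `tch(ψ, ην½⁻¹, ην½)`, each with multiplicity one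

Cell `pub/hodgecm-mathlib` (D-0151), Track B, seat K2E5-p17 (g7); head «=» architect K2E3-p25 (g2) (bus 11:28:14Z), asked for by the case bricks C2 (K2E3-p11 (g7), bus 11:17:44Z) and
C1′∕C1″ (K2E3-p17 (g8), CENSUS-C1prime v0 §0); plan K2E3-p21 (g6) `MEMO-GEOQB-handoff.v1` §1, §4.  `--supports stmt-HodgeConjecture-24833 --as helper`; THEOREMS ONLY (no definition ∕
instance ∕ notation ∕ `sorry`); never imports `Cruxes/…/Lines`; COUNT-NEUTRAL.

CURRENCY (architect MEMO-SA-architecture v2 §0 ∕ ★ STD-EMB ∕ ★ H0-a, spelled inline): `T := Π a : Fin 3, GL {i // id i = a} F` (diagonal torus), `Q := standardParabolicGL F ![f,f,t]` (`P₂₁`),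
`M_Q := Π a : Bool, GL {i // ![f,f,t] i = a} F`, `ψ_Q := (η ∘ det ∘ ev_false) · (ψ ∘ det ∘ ev_true)`, `D η ψ := parabolicIndGL F ![f,f,t] (𝟙.twist ψ_Q)` (★ STD-EMB; `= smoothIndRep Q σ′_Q`
by `rfl`), `ν½ := (unramifiedTwist F (1/2)).toMonoidHom`, `θ_D := ![η ν½⁻¹, η ν½, ψ]`, `tch θ := ∏ a, (θ a) ∘ det ∘ ev_a`, `mult V ζ := finrank ℂ ↥(⨅ m, maxGenEigenspace (normalizedJacquetGL F id V m) (ζ m))`.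

THE MATHEMATICS ([BernsteinZelevinsky1977, §2.12 and Thm. 5.2 — the geometric lemma for the pair `(Q, B)`]; [Zelevinsky1980, §1.2, §1.6, Thm. 1.2]; [Casselman1995, §6.3]).  The `(Q,B)`
double cosets of `GL₃` are `Q P_w B` for the three shuffles `w ∈ {1, s₂, s₁s₂}` keeping the two `GL₂`-letters in order; they are linearly ordered by ★ `cellKey ![f,f,t]` and give a
`T`-stable filtration `X_w^< = {f : f|_{cellLT w} = 0}` of `Ind_Q σ′` whose images in `J = r_U(Ind_Q σ′)` have successive quotients LINES (★ (G3a)∕(G3b): one line per cell, character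
`χ ∘ Ad(P_w)` when `σ′|_B = δ_B^{1∕2}·(χ∘proj_B)`); ★ E3α `finrank_weightSpace_eq_card_of_lineFiltration` turns this into the exponent count.  For `D(η,ψ)`: `σ′_Q|_B = δ_B^{1∕2} · tch θ_D`
(★ (G3a) `inducingCharQ_apply_borel`) and `tch θ_D ∘ Ad(P_w) = tch (θ_D ∘ w⁻¹)` (★ H0-a `tch_leviProjection_permGL_conj`), so
**`r_U(D(η,ψ))` is finite-dimensional and `mult (D η ψ) ζ = #{w ∈ {1, s₂, s₁s₂} : ζ = tch (θ_D ∘ w⁻¹)}`** — the exponents of `D(η,ψ)` are `(ην½⁻¹,ην½,ψ)`, `(ην½⁻¹,ψ,ην½)`, `(ψ,ην½⁻¹,ην½)`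
(for `w = s₁s₂`, `θ ∘ w⁻¹ = (θ₂, θ₀, θ₁)`), i.e. the half of the six exponents of `I(θ_D)` (★ H0-a) in which `ην½⁻¹` precedes `ην½` — as it must, `D` being `Ind_Q` of the
subrepresentation `η∘det₂ ⊂ I₂(ην½⁻¹, ην½)` whose exponent is `(ην½⁻¹, ην½)`.
* §1 the per-cell line for each of the three representatives (★ (G3a) §4, ★ (G3b)); the `(Q,B)`-filtration is `T`-stable.
* §2 the keys: every `cellKey ![f,f,t] τ` is the key of `1`, `s₂` or `s₁s₂`, and these three are distinct.
* §3 **`finrank_weightSpace_normalizedJacquetGL_smoothIndRep_twoOne`** — the GENERAL count for any smooth `σ′` on `ℂ` with `σ′|_B = δ_B^{1∕2}·(χ∘proj_B)` (★ E3δ's assembly with 3 keys).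
* §4 **`finrank_weightSpace_normalizedJacquetGL_D`** — THE HEAD for `D(η,ψ)` in the `tch`-currency of ★ H0-a; `finiteDimensional_jacquet_D`; **`finrank_weightSpace_D_eq`** — the
  same table as a sum of three indicators over the plain triples (the shape C2∕C1′ read).
HONEST LABEL: HC_CM is proved only modulo the 7 printed citations (2 remaining named inputs: hLiu418 = stmt-HodgeConjecture-24832, h413 = stmt-HodgeConjecture-24833) until rung 0
closes; count-neutral helper (representation theory of `GL₃(F)`; no printed citation is discharged).

## Mathlib ∕ tree search
Tree ★: E3α `K2E3JacquetFiltrationMultiplicity.finrank_weightSpace_eq_card_of_lineFiltration` · E3δ `K2E3GL3BorelJacquetExponents` (assembly template, `perm_fin_three_cases`) · H0-a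
`tch_leviProjection_permGL_conj` · (G2) `mul_blockDiagonalGL_mem_cellsBelow` · `cellKey_eq_iff`, `parabolicDoubleCoset_eq_of_comp_symm_eq`, `cellLT_eq_empty`, `cellLE_rev_eq_univ`,
`cellKey_le_cellKey_rev`, `mem_cellsBelow_iff` (`ParabolicBruhatCellsTopology`) · `K2E3GLnPrincipalBlockEmbedding.levi_id_mul_comm` · `normalizedJacquetGL_mk`.  Mathlib: `Finset.orderEmbOfFin`,
`Finset.card_image_of_injOn`, `Finset.card_bij`.  Dedup: `rg "StandardModuleJacquetDimension|smoothIndRep_twoOne|cellKey_twoOne"` over `Theorems/` — none.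

## References
* [BernsteinZelevinsky1977] I. N. Bernstein, A. V. Zelevinsky, *Induced representations of reductive p-adic groups I*, Ann. Sci. ÉNS 10 (1977), §2.12, Thm. 5.2.
* [Zelevinsky1980] A. V. Zelevinsky, *Induced representations of reductive p-adic groups II*, Ann. Sci. ÉNS 13 (1980), §1.2, §1.6, Thm. 1.2.
* [Casselman1995] W. Casselman, *Introduction to the theory of admissible representations of p-adic reductive groups* (draft 1995), §6.3 (Thm. 6.3.5).
-/

set_option autoImplicit false
-- the mandated namespace repeats `HodgeConjecture.HodgeConjecture`, as in every `Theorems/*.lean` of this sub-problem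
set_option linter.dupNamespace false

noncomputable section

open Set Function MeasureTheory Representation Module
open scoped MatrixGroups

namespace Summit.HodgeConjecture.HodgeConjecture.Cruxes.H413.K2E3GL3StandardModuleJacquetDimension

open Literature.NumberTheory.Automorphic ValuativeRel
open Summit.HodgeConjecture.HodgeConjecture.Cruxes.H413.K2E3BorelCellJacquetLine (permGL_conj_blockDiagonalGL_mem_borel)
open Summit.HodgeConjecture.HodgeConjecture.Cruxes.H413.K2E3GL3InductionInStagesEmbedding (monotone_twoOne)
open Summit.HodgeConjecture.HodgeConjecture.Cruxes.H413.K2E3JacquetFiltrationMultiplicity (finrank_weightSpace_eq_card_of_lineFiltration)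
open Summit.HodgeConjecture.HodgeConjecture.Cruxes.H413.K2E3GL3BorelJacquetExponents (perm_fin_three_cases)
open Summit.HodgeConjecture.HodgeConjecture.Cruxes.H413.K2E3GL3StandardModuleJacquetCells
open Summit.HodgeConjecture.HodgeConjecture.Cruxes.H413.K2E3GL3StandardModuleJacquetLines

variable {F : Type} [Field F] [ValuativeRel F] [TopologicalSpace F] [IsNonarchimedeanLocalField F]

/-! ## §1 One line per `(Q,B)`-cell representative; the `(Q,B)`-filtration is `T`-stable -/

section Cells

variable (σ' : Representation ℂ ↥(standardParabolicGL F (![false, false, true] : Fin 3 → Bool)) ℂ) (χ : (Π a : Fin 3, GL {i : Fin 3 // (id : Fin 3 → Fin 3) i = a} F) →* ℂˣ)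

/-- **Each of the three `(Q,B)`-cells `w ∈ {1, s₂, s₁s₂}` contributes exactly a line to `r_U(Ind_Q σ′)`, with exponent `χ ∘ Ad(P_w)`** (★ (G3a) `exists_lineFunctional_cellQ_one`,
★ (G3b) `exists_lineFunctional_cellQ_swap_one_two` ∕ `_cycle_one_two_zero`), for `σ′` smooth on `ℂ` with `σ′|_B = δ_B^{1∕2}·(χ∘proj_B)`.
[cite: BernsteinZelevinsky1977, Thm. 5.2] [cite: Casselman1995, §6.3, Thm. 6.3.5] -/
theorem exists_lineFunctional_cellQ (hσ' : σ'.IsSmooth)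
    (hσB : ∀ (g : GL (Fin 3) F) (hg : g ∈ standardParabolicGL F (id : Fin 3 → Fin 3)) (z : ℂ),
      σ' ⟨g, borel_le_standardParabolicGL monotone_twoOne hg⟩ z =
        ((rootDeltaChar (standardParabolicGL F (id : Fin 3 → Fin 3)) ⟨g, hg⟩ : ℂˣ) : ℂ) * ((((χ (leviProjection F (id : Fin 3 → Fin 3) ⟨g, hg⟩)) : ℂˣ) : ℂ) * z))
    (w : Equiv.Perm (Fin 3)) (hw : w = 1 ∨ w = Equiv.swap (1 : Fin 3) 2 ∨ w = Equiv.swap (0 : Fin 3) 1 * Equiv.swap (1 : Fin 3) 2) :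
    ∃ Λ : (restrictUnipotentGL F (id : Fin 3 → Fin 3) (smoothIndRep (standardParabolicGL F (![false, false, true] : Fin 3 → Bool)) σ')).Coinvariants →ₗ[ℂ] ℂ,
      (∀ x ∈ ((vanishingOn (standardParabolicGL F (![false, false, true] : Fin 3 → Bool)) σ' (cellLT (K := F) (![false, false, true] : Fin 3 → Bool) w))).map (Coinvariants.mk (restrictUnipotentGL F (id : Fin 3 → Fin 3) (smoothIndRep (standardParabolicGL F (![false, false, true] : Fin 3 → Bool)) σ'))), Λ x = 0 ↔ x ∈ ((vanishingOn (standardParabolicGL F (![false, false, true] : Fin 3 → Bool)) σ' (cellLE (K := F) (![false, false, true] : Fin 3 → Bool) w))).map (Coinvariants.mk (restrictUnipotentGL F (id : Fin 3 → Fin 3) (smoothIndRep (standardParabolicGL F (![false, false, true] : Fin 3 → Bool)) σ')))) ∧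
      (∃ x ∈ ((vanishingOn (standardParabolicGL F (![false, false, true] : Fin 3 → Bool)) σ' (cellLT (K := F) (![false, false, true] : Fin 3 → Bool) w))).map (Coinvariants.mk (restrictUnipotentGL F (id : Fin 3 → Fin 3) (smoothIndRep (standardParabolicGL F (![false, false, true] : Fin 3 → Bool)) σ'))), Λ x ≠ 0) ∧
      ∀ (m : (Π a : Fin 3, GL {i : Fin 3 // (id : Fin 3 → Fin 3) i = a} F)), ∀ x ∈ ((vanishingOn (standardParabolicGL F (![false, false, true] : Fin 3 → Bool)) σ' (cellLT (K := F) (![false, false, true] : Fin 3 → Bool) w))).map (Coinvariants.mk (restrictUnipotentGL F (id : Fin 3 → Fin 3) (smoothIndRep (standardParabolicGL F (![false, false, true] : Fin 3 → Bool)) σ'))),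
        Λ (Representation.normalizedJacquetGL F (id : Fin 3 → Fin 3) (smoothIndRep (standardParabolicGL F (![false, false, true] : Fin 3 → Bool)) σ') m x) = ((χ (leviProjection F (id : Fin 3 → Fin 3) ⟨(permGL (w) : GL (Fin 3) F) * blockDiagonalGL F (id : Fin 3 → Fin 3) m * (permGL (w) : GL (Fin 3) F)⁻¹, permGL_conj_blockDiagonalGL_mem_borel (w) m⟩) : ℂˣ) : ℂ) * Λ x := by
  obtain rfl | rfl | rfl := hw
  · exact exists_lineFunctional_cellQ_one σ' χ hσ' hσB
  · exact exists_lineFunctional_cellQ_swap_one_two σ' χ hσ' hσB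
  · exact exists_lineFunctional_cellQ_cycle_one_two_zero σ' χ hσ' hσB

/-- **The `(Q,B)`-filtration is torus-stable**: `r(m)` maps `[vanishingOn (cellsBelow ![f,f,t] D)]` into itself (★ (G2) `mul_blockDiagonalGL_mem_cellsBelow`).
[cite: BernsteinZelevinsky1977, Thm. 5.2] -/
theorem normalizedJacquetGL_mem_map_vanishingOn_cellsBelow (D : Set (ℕ ×ₗ Lex (Fin 3 → Bool))) (m : (Π a : Fin 3, GL {i : Fin 3 // (id : Fin 3 → Fin 3) i = a} F)) {x : (restrictUnipotentGL F (id : Fin 3 → Fin 3) (smoothIndRep (standardParabolicGL F (![false, false, true] : Fin 3 → Bool)) σ')).Coinvariants}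
    (hx : x ∈ ((vanishingOn (standardParabolicGL F (![false, false, true] : Fin 3 → Bool)) σ' (cellsBelow (K := F) (![false, false, true] : Fin 3 → Bool) D))).map (Coinvariants.mk (restrictUnipotentGL F (id : Fin 3 → Fin 3) (smoothIndRep (standardParabolicGL F (![false, false, true] : Fin 3 → Bool)) σ')))) :
    Representation.normalizedJacquetGL F (id : Fin 3 → Fin 3) (smoothIndRep (standardParabolicGL F (![false, false, true] : Fin 3 → Bool)) σ') m x ∈ ((vanishingOn (standardParabolicGL F (![false, false, true] : Fin 3 → Bool)) σ' (cellsBelow (K := F) (![false, false, true] : Fin 3 → Bool) D))).map (Coinvariants.mk (restrictUnipotentGL F (id : Fin 3 → Fin 3) (smoothIndRep (standardParabolicGL F (![false, false, true] : Fin 3 → Bool)) σ'))) := by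
  obtain ⟨f, hf, rfl⟩ := hx
  rw [Representation.normalizedJacquetGL_mk]
  refine Submodule.smul_mem _ _ ⟨_, fun g hg => ?_, rfl⟩
  rw [toFun_smoothIndRep_apply]
  exact hf _ (K2E3ParabolicCellJacquetLine.mul_blockDiagonalGL_mem_cellsBelow (![false, false, true] : Fin 3 → Bool) monotone_twoOne D hg m)

end Cells

/-! ## §2 The three keys of `Q\GL₃/B` -/

omit [ValuativeRel F] [TopologicalSpace F] [IsNonarchimedeanLocalField F] [Field F] in
/-- Every `(Q,B)`-cell of `GL₃` is the cell of `1`, `s₂` or `s₁s₂`: `key τ ∈ {key 1, key s₂, key (s₁s₂)}` (the block word `![f,f,t] ∘ τ⁻¹` only remembers `τ 2`; `key s₁ = key 1`,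
`key (s₂s₁) = key s₂`, `key w₀ = key (s₁s₂)`). [cite: BernsteinZelevinsky1977, §2.12, Thm. 5.2] -/
theorem cellKey_twoOne_cases (τ : Equiv.Perm (Fin 3)) :
    cellKey (![false, false, true] : Fin 3 → Bool) τ = cellKey (![false, false, true] : Fin 3 → Bool) (1 : Equiv.Perm (Fin 3)) ∨ cellKey (![false, false, true] : Fin 3 → Bool) τ = cellKey (![false, false, true] : Fin 3 → Bool) (Equiv.swap (1 : Fin 3) 2) ∨
      cellKey (![false, false, true] : Fin 3 → Bool) τ = cellKey (![false, false, true] : Fin 3 → Bool) (Equiv.swap (0 : Fin 3) 1 * Equiv.swap (1 : Fin 3) 2) := by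
  have key : ∀ {σ ρ : Equiv.Perm (Fin 3)}, (![false, false, true] : Fin 3 → Bool) ∘ ⇑σ.symm = (![false, false, true] : Fin 3 → Bool) ∘ ⇑ρ.symm → cellKey (![false, false, true] : Fin 3 → Bool) σ = cellKey (![false, false, true] : Fin 3 → Bool) ρ := fun h =>
    (cellKey_eq_iff (K := ℚ) (![false, false, true] : Fin 3 → Bool)).2 (parabolicDoubleCoset_eq_of_comp_symm_eq (![false, false, true] : Fin 3 → Bool) h)
  obtain rfl | rfl | rfl | rfl | rfl | rfl := perm_fin_three_cases τ
  · exact Or.inl rfl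
  · exact Or.inl (key (by decide))
  · exact Or.inr (Or.inl rfl)
  · exact Or.inr (Or.inr rfl)
  · exact Or.inr (Or.inl (key (by decide)))
  · exact Or.inr (Or.inr (key (by decide)))

omit [ValuativeRel F] [TopologicalSpace F] [IsNonarchimedeanLocalField F] [Field F] in
/-- The three keys `key 1`, `key s₂`, `key (s₁s₂)` of `Q\GL₃/B` are pairwise distinct (their block words `(f,f,t)`, `(f,t,f)`, `(t,f,f)` differ). [cite: BernsteinZelevinsky1977, §2.12] -/
theorem cellKey_twoOne_ne :
    cellKey (![false, false, true] : Fin 3 → Bool) (1 : Equiv.Perm (Fin 3)) ≠ cellKey (![false, false, true] : Fin 3 → Bool) (Equiv.swap (1 : Fin 3) 2) ∧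
    cellKey (![false, false, true] : Fin 3 → Bool) (1 : Equiv.Perm (Fin 3)) ≠ cellKey (![false, false, true] : Fin 3 → Bool) (Equiv.swap (0 : Fin 3) 1 * Equiv.swap (1 : Fin 3) 2) ∧
    cellKey (![false, false, true] : Fin 3 → Bool) (Equiv.swap (1 : Fin 3) 2) ≠ cellKey (![false, false, true] : Fin 3 → Bool) (Equiv.swap (0 : Fin 3) 1 * Equiv.swap (1 : Fin 3) 2) := by
  have word : ∀ {σ ρ : Equiv.Perm (Fin 3)}, cellKey (![false, false, true] : Fin 3 → Bool) σ = cellKey (![false, false, true] : Fin 3 → Bool) ρ → (![false, false, true] : Fin 3 → Bool) ∘ ⇑σ.symm = (![false, false, true] : Fin 3 → Bool) ∘ ⇑ρ.symm := fun h => by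
    have := congrArg (fun x => ofLex (ofLex x).2) h
    simpa [cellKey] using this
  exact ⟨fun h => absurd (word h) (by decide), fun h => absurd (word h) (by decide), fun h => absurd (word h) (by decide)⟩

/-! ## §3 The geometric lemma for `(Q, B)`: the exponent count of `Ind_Q σ′` for `σ′|_B = δ_B^{1∕2}·(χ∘proj_B)` -/

section General

variable (σ' : Representation ℂ ↥(standardParabolicGL F (![false, false, true] : Fin 3 → Bool)) ℂ) (χ : (Π a : Fin 3, GL {i : Fin 3 // (id : Fin 3 → Fin 3) i = a} F) →* ℂˣ)

set_option maxHeartbeats 800000 in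
open scoped Classical in
/-- **THE GEOMETRIC LEMMA FOR `(Q,B)` IN `GL₃` (exponent multiset of `Ind_Q σ′`).**  Let `σ′` be a smooth representation of `Q = P₂₁` on `ℂ` whose restriction to `B ≤ Q` is the Borel
inducing character `δ_B^{1∕2}·(χ∘proj_B)` of a character `χ` of `T`.  Then `r_U(Ind_Q σ′)` is finite-dimensional and, for every `η : T → ℂ`, the generalised `η`-weight space of the
NORMALISED torus action `normalizedJacquetGL F id (Ind_Q σ′)` has dimension `#{w ∈ {1, s₂, s₁s₂} : η = χ ∘ proj_B ∘ Ad(P_w) ∘ diag}` — the exponents are the three `χ ∘ Ad(P_w)`, `w` running over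
the `(Q,B)`-cell representatives (★ E3δ's assembly of ★ E3α over the 3-step filtration by ★ `cellKey ![f,f,t]`, with the per-cell lines of §1).
[cite: BernsteinZelevinsky1977, §2.12, Thm. 5.2] [cite: Zelevinsky1980, §1.2, Thm. 1.2] [cite: Casselman1995, §6.3, Thm. 6.3.5] -/
theorem finrank_weightSpace_normalizedJacquetGL_smoothIndRep_twoOne (hσ' : σ'.IsSmooth)
    (hσB : ∀ (g : GL (Fin 3) F) (hg : g ∈ standardParabolicGL F (id : Fin 3 → Fin 3)) (z : ℂ),
      σ' ⟨g, borel_le_standardParabolicGL monotone_twoOne hg⟩ z =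
        ((rootDeltaChar (standardParabolicGL F (id : Fin 3 → Fin 3)) ⟨g, hg⟩ : ℂˣ) : ℂ) * ((((χ (leviProjection F (id : Fin 3 → Fin 3) ⟨g, hg⟩)) : ℂˣ) : ℂ) * z))
    (η : (Π a : Fin 3, GL {i : Fin 3 // (id : Fin 3 → Fin 3) i = a} F) → ℂ) :
    FiniteDimensional ℂ (restrictUnipotentGL F (id : Fin 3 → Fin 3) (smoothIndRep (standardParabolicGL F (![false, false, true] : Fin 3 → Bool)) σ')).Coinvariants ∧
    finrank ℂ ↥(⨅ m, Module.End.maxGenEigenspace (Representation.normalizedJacquetGL F (id : Fin 3 → Fin 3) (smoothIndRep (standardParabolicGL F (![false, false, true] : Fin 3 → Bool)) σ') m) (η m)) =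
      (({1, Equiv.swap (1 : Fin 3) 2, Equiv.swap (0 : Fin 3) 1 * Equiv.swap (1 : Fin 3) 2} : Finset (Equiv.Perm (Fin 3))).filter fun w => η = fun m => ((χ (leviProjection F (id : Fin 3 → Fin 3) ⟨(permGL (w) : GL (Fin 3) F) * blockDiagonalGL F (id : Fin 3 → Fin 3) m * (permGL (w) : GL (Fin 3) F)⁻¹, permGL_conj_blockDiagonalGL_mem_borel (w) m⟩) : ℂˣ) : ℂ)).card := by
  classical
  -- the three representatives, their keys, and the key set `s` of cardinality 3
  have hR : ∀ v : Equiv.Perm (Fin 3), v ∈ ({1, Equiv.swap (1 : Fin 3) 2, Equiv.swap (0 : Fin 3) 1 * Equiv.swap (1 : Fin 3) 2} : Finset (Equiv.Perm (Fin 3))) ↔ v = 1 ∨ v = Equiv.swap (1 : Fin 3) 2 ∨ v = Equiv.swap (0 : Fin 3) 1 * Equiv.swap (1 : Fin 3) 2 := fun v => by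
    simp only [Finset.mem_insert, Finset.mem_singleton]
  obtain ⟨hk12, hk13, hk23⟩ := cellKey_twoOne_ne
  have hinjR : ∀ v ∈ ({1, Equiv.swap (1 : Fin 3) 2, Equiv.swap (0 : Fin 3) 1 * Equiv.swap (1 : Fin 3) 2} : Finset (Equiv.Perm (Fin 3))), ∀ v' ∈ ({1, Equiv.swap (1 : Fin 3) 2, Equiv.swap (0 : Fin 3) 1 * Equiv.swap (1 : Fin 3) 2} : Finset (Equiv.Perm (Fin 3))), cellKey (![false, false, true] : Fin 3 → Bool) v = cellKey (![false, false, true] : Fin 3 → Bool) v' → v = v' := by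
    intro v hv v' hv' h
    rw [hR] at hv hv'
    obtain rfl | rfl | rfl := hv <;> obtain rfl | rfl | rfl := hv' <;>
      first | rfl | exact absurd h hk12 | exact absurd h.symm hk12 | exact absurd h hk13 | exact absurd h.symm hk13 | exact absurd h hk23 | exact absurd h.symm hk23
  let s : Finset (ℕ ×ₗ Lex (Fin 3 → Bool)) := ({1, Equiv.swap (1 : Fin 3) 2, Equiv.swap (0 : Fin 3) 1 * Equiv.swap (1 : Fin 3) 2} : Finset (Equiv.Perm (Fin 3))).image fun σ : Equiv.Perm (Fin 3) => cellKey (![false, false, true] : Fin 3 → Bool) σ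
  have hs : s.card = 3 := by
    rw [Finset.card_image_of_injOn (fun v hv v' hv' h => hinjR v hv v' hv' h)]
    decide
  have hsuniv : ∀ τ : Equiv.Perm (Fin 3), cellKey (![false, false, true] : Fin 3 → Bool) τ ∈ s := fun τ => by
    obtain h | h | h := cellKey_twoOne_cases τ
    · exact Finset.mem_image.2 ⟨1, (hR 1).2 (Or.inl rfl), h.symm⟩
    · exact Finset.mem_image.2 ⟨Equiv.swap (1 : Fin 3) 2, (hR _).2 (Or.inr (Or.inl rfl)), h.symm⟩
    · exact Finset.mem_image.2 ⟨Equiv.swap (0 : Fin 3) 1 * Equiv.swap (1 : Fin 3) 2, (hR _).2 (Or.inr (Or.inr rfl)), h.symm⟩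
  let k : Fin 3 ↪o ℕ ×ₗ Lex (Fin 3 → Bool) := s.orderEmbOfFin hs
  have hkmem : ∀ j : Fin 3, ∃ σ : Equiv.Perm (Fin 3), σ ∈ ({1, Equiv.swap (1 : Fin 3) 2, Equiv.swap (0 : Fin 3) 1 * Equiv.swap (1 : Fin 3) 2} : Finset (Equiv.Perm (Fin 3))) ∧ cellKey (![false, false, true] : Fin 3 → Bool) σ = k j := fun j => by
    obtain ⟨σ, hσ, hσk⟩ := Finset.mem_image.1 (s.orderEmbOfFin_mem hs j)
    exact ⟨σ, hσ, hσk⟩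
  choose w hwR hw using hkmem
  have hsurj : ∀ τ : Equiv.Perm (Fin 3), ∃ j : Fin 3, cellKey (![false, false, true] : Fin 3 → Bool) τ = k j := fun τ => by
    have hτ : cellKey (![false, false, true] : Fin 3 → Bool) τ ∈ Set.range k := by
      rw [Finset.range_orderEmbOfFin, Finset.mem_coe]
      exact hsuniv τ
    obtain ⟨j, hj⟩ := hτ
    exact ⟨j, hj.symm⟩
  have hwinj : Function.Injective w := fun i j h => k.injective (by rw [← hw i, ← hw j, h])
  -- consecutive keys: `cellLT (w (j+1)) = cellLE (w j)`, `cellLT (w 0) = ∅`, `cellLE (w 2) = univ`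
  have hstep : ∀ (j : ℕ) (hj : j + 1 < 3), cellLT (K := F) (![false, false, true] : Fin 3 → Bool) (w ⟨j + 1, hj⟩) = cellLE (K := F) (![false, false, true] : Fin 3 → Bool) (w ⟨j, by omega⟩) := by
    intro j hj
    change cellsBelow (K := F) (![false, false, true] : Fin 3 → Bool) (Set.Iio (cellKey (![false, false, true] : Fin 3 → Bool) (w ⟨j + 1, hj⟩))) =
      cellsBelow (K := F) (![false, false, true] : Fin 3 → Bool) (Set.Iic (cellKey (![false, false, true] : Fin 3 → Bool) (w ⟨j, by omega⟩)))
    ext g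
    simp only [mem_cellsBelow_iff, Set.mem_Iio, Set.mem_Iic, hw]
    refine exists_congr fun τ => and_congr_left fun _ => ?_
    obtain ⟨i, hi⟩ := hsurj τ
    rw [hi, k.lt_iff_lt, k.le_iff_le, Fin.lt_def, Fin.le_def]
    exact Nat.lt_succ_iff
  have hbot : cellLT (K := F) (![false, false, true] : Fin 3 → Bool) (w ⟨0, by omega⟩) = ∅ := by
    refine cellLT_eq_empty (K := F) (![false, false, true] : Fin 3 → Bool) fun ⟨τ, hτ⟩ => ?_
    obtain ⟨i, hi⟩ := hsurj τ
    rw [hw, hi, k.lt_iff_lt] at hτ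
    exact (not_lt.2 (Fin.zero_le i)) hτ
  have htop : cellLE (K := F) (![false, false, true] : Fin 3 → Bool) (w ⟨2, by omega⟩) = Set.univ := by
    refine Set.eq_univ_of_univ_subset ?_
    rw [← cellLE_rev_eq_univ (K := F) (![false, false, true] : Fin 3 → Bool) monotone_twoOne]
    rintro g ⟨τ, hτ, hg⟩
    refine ⟨τ, ?_, hg⟩
    obtain ⟨i, hi⟩ := hsurj Fin.revPerm
    simp only [Set.mem_Iic] at hτ ⊢
    refine hτ.trans ?_
    rw [hi, hw, k.le_iff_le]
    exact Fin.le_last i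
  -- the per-cell lines
  have hcell := fun j : Fin 3 => exists_lineFunctional_cellQ σ' χ hσ' hσB (w j) ((hR _).1 (hwR j))
  choose Λw hkerw hnew hequivw using hcell
  -- the filtration, functionals and characters indexed by `ℕ`
  let Fl : ℕ → Submodule ℂ (restrictUnipotentGL F (id : Fin 3 → Fin 3) (smoothIndRep (standardParabolicGL F (![false, false, true] : Fin 3 → Bool)) σ')).Coinvariants := fun j =>
    if h : j < 3 then ((vanishingOn (standardParabolicGL F (![false, false, true] : Fin 3 → Bool)) σ' (cellLT (K := F) (![false, false, true] : Fin 3 → Bool) (w ⟨j, h⟩)))).map (Coinvariants.mk (restrictUnipotentGL F (id : Fin 3 → Fin 3) (smoothIndRep (standardParabolicGL F (![false, false, true] : Fin 3 → Bool)) σ'))) else ⊥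
  have hFl : ∀ (j : ℕ) (h : j < 3), Fl j = ((vanishingOn (standardParabolicGL F (![false, false, true] : Fin 3 → Bool)) σ' (cellLT (K := F) (![false, false, true] : Fin 3 → Bool) (w ⟨j, h⟩)))).map (Coinvariants.mk (restrictUnipotentGL F (id : Fin 3 → Fin 3) (smoothIndRep (standardParabolicGL F (![false, false, true] : Fin 3 → Bool)) σ'))) := fun j h => dif_pos h
  have hFl' : ∀ j : ℕ, ¬ j < 3 → Fl j = ⊥ := fun j h => dif_neg h
  have hFle : ∀ (j : ℕ) (h : j < 3), Fl (j + 1) = ((vanishingOn (standardParabolicGL F (![false, false, true] : Fin 3 → Bool)) σ' (cellLE (K := F) (![false, false, true] : Fin 3 → Bool) (w ⟨j, h⟩)))).map (Coinvariants.mk (restrictUnipotentGL F (id : Fin 3 → Fin 3) (smoothIndRep (standardParabolicGL F (![false, false, true] : Fin 3 → Bool)) σ'))) := by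
    intro j h
    by_cases hj : j + 1 < 3
    · rw [hFl _ hj, hstep j hj]
    · have hj2 : j = 2 := by omega
      subst hj2
      rw [hFl' _ hj, htop]
      have hvan : vanishingOn (standardParabolicGL F (![false, false, true] : Fin 3 → Bool)) σ' (Set.univ : Set (GL (Fin 3) F)) = ⊥ :=
        eq_bot_iff.2 fun f hf => (Submodule.mem_bot ℂ).2 (SmoothInd.ext (funext fun g => by rw [hf g (Set.mem_univ g)]; rfl))
      rw [hvan, Submodule.map_bot]
  let conjB : Equiv.Perm (Fin 3) → ((Π a : Fin 3, GL {i : Fin 3 // (id : Fin 3 → Fin 3) i = a} F) →* ↥(standardParabolicGL F (id : Fin 3 → Fin 3))) := fun v =>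
    ((MulAut.conj (permGL v : GL (Fin 3) F)).toMonoidHom.comp (blockDiagonalGL F (id : Fin 3 → Fin 3))).codRestrict (standardParabolicGL F (id : Fin 3 → Fin 3))
      (fun m => permGL_conj_blockDiagonalGL_mem_borel v m)
  let cw : Equiv.Perm (Fin 3) → ((Π a : Fin 3, GL {i : Fin 3 // (id : Fin 3 → Fin 3) i = a} F) →* ℂˣ) := fun v => χ.comp ((leviProjection F (id : Fin 3 → Fin 3)).comp (conjB v))
  have hcw : ∀ (v : Equiv.Perm (Fin 3)) (m : (Π a : Fin 3, GL {i : Fin 3 // (id : Fin 3 → Fin 3) i = a} F)), ((cw v m : ℂˣ) : ℂ) =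
      ((χ (leviProjection F (id : Fin 3 → Fin 3) ⟨(permGL v : GL (Fin 3) F) * blockDiagonalGL F (id : Fin 3 → Fin 3) m * (permGL v : GL (Fin 3) F)⁻¹, permGL_conj_blockDiagonalGL_mem_borel v m⟩) : ℂˣ) : ℂ) :=
    fun v m => rfl
  have hcomm : ∀ m m' : (Π a : Fin 3, GL {i : Fin 3 // (id : Fin 3 → Fin 3) i = a} F), Commute (Representation.normalizedJacquetGL F (id : Fin 3 → Fin 3) (smoothIndRep (standardParabolicGL F (![false, false, true] : Fin 3 → Bool)) σ') m) (Representation.normalizedJacquetGL F (id : Fin 3 → Fin 3) (smoothIndRep (standardParabolicGL F (![false, false, true] : Fin 3 → Bool)) σ') m') := fun m m' => by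
    change Representation.normalizedJacquetGL F (id : Fin 3 → Fin 3) (smoothIndRep (standardParabolicGL F (![false, false, true] : Fin 3 → Bool)) σ') m * Representation.normalizedJacquetGL F (id : Fin 3 → Fin 3) (smoothIndRep (standardParabolicGL F (![false, false, true] : Fin 3 → Bool)) σ') m' = _
    rw [← map_mul, K2E3GLnPrincipalBlockEmbedding.levi_id_mul_comm m m', map_mul]
  have h0 : Fl 0 = ⊤ := by
    rw [hFl 0 (by omega), hbot]
    have htop' : vanishingOn (standardParabolicGL F (![false, false, true] : Fin 3 → Bool)) σ' (∅ : Set (GL (Fin 3) F)) = ⊤ := eq_top_iff.2 fun f _ g hg => hg.elim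
    rw [htop', Submodule.map_top, LinearMap.range_eq_top]
    exact Coinvariants.mk_surjective _
  have h3 : Fl 3 = ⊥ := hFl' 3 (by omega)
  have hanti : ∀ j, Fl (j + 1) ≤ Fl j := fun j => by
    by_cases h : j < 3
    · rw [hFle j h, hFl j h]
      exact Submodule.map_mono (vanishingOn_mono (cellLT_subset_cellLE (K := F) (![false, false, true] : Fin 3 → Bool) _))
    · rw [hFl' (j + 1) (by omega)]; exact bot_le
  have hst : ∀ j m, ∀ x ∈ Fl j, Representation.normalizedJacquetGL F (id : Fin 3 → Fin 3) (smoothIndRep (standardParabolicGL F (![false, false, true] : Fin 3 → Bool)) σ') m x ∈ Fl j := fun j m x hx => by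
    by_cases h : j < 3
    · rw [hFl j h] at hx ⊢
      exact normalizedJacquetGL_mem_map_vanishingOn_cellsBelow σ' _ m hx
    · rw [hFl' j h] at hx ⊢
      rw [(Submodule.mem_bot ℂ).1 hx, map_zero]; exact Submodule.zero_mem _
  let Λ : ℕ → ((restrictUnipotentGL F (id : Fin 3 → Fin 3) (smoothIndRep (standardParabolicGL F (![false, false, true] : Fin 3 → Bool)) σ')).Coinvariants →ₗ[ℂ] ℂ) := fun j => if h : j < 3 then Λw ⟨j, h⟩ else 0
  let c : ℕ → ((Π a : Fin 3, GL {i : Fin 3 // (id : Fin 3 → Fin 3) i = a} F) →* ℂˣ) := fun j => if h : j < 3 then cw (w ⟨j, h⟩) else 1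
  have hΛ : ∀ (j : ℕ) (h : j < 3), Λ j = Λw ⟨j, h⟩ := fun j h => dif_pos h
  have hc : ∀ (j : ℕ) (h : j < 3), c j = cw (w ⟨j, h⟩) := fun j h => dif_pos h
  have hker : ∀ j < 3, ∀ x ∈ Fl j, Λ j x = 0 ↔ x ∈ Fl (j + 1) := fun j hj x hx => by
    rw [hΛ j hj, hFle j hj]
    rw [hFl j hj] at hx
    exact hkerw ⟨j, hj⟩ x hx
  have hne : ∀ j < 3, ∃ x ∈ Fl j, Λ j x ≠ 0 := fun j hj => by
    rw [hΛ j hj, hFl j hj]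
    exact hnew ⟨j, hj⟩
  have hequiv : ∀ j < 3, ∀ m, ∀ x ∈ Fl j, Λ j (Representation.normalizedJacquetGL F (id : Fin 3 → Fin 3) (smoothIndRep (standardParabolicGL F (![false, false, true] : Fin 3 → Bool)) σ') m x) = c j m * Λ j x :=
    fun j hj m x hx => by
    rw [hFl j hj] at hx
    rw [hΛ j hj, hc j hj, hequivw ⟨j, hj⟩ m x hx, hcw]
  obtain ⟨hfd, hcount⟩ := finrank_weightSpace_eq_card_of_lineFiltration (Representation.normalizedJacquetGL F (id : Fin 3 → Fin 3) (smoothIndRep (standardParabolicGL F (![false, false, true] : Fin 3 → Bool)) σ'))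
    hcomm 3 Fl h0 h3 hanti hst Λ c hker hne hequiv η
  refine ⟨hfd, hcount.trans ?_⟩
  -- reindex the count: `j ↦ w j` is a bijection `range 3 → {1, s₂, s₁s₂}`
  refine Finset.card_bij (fun (j : ℕ) _ => if h : j < 3 then w ⟨j, h⟩ else 1) ?_ ?_ ?_
  · intro j hj
    obtain ⟨hj3, hη⟩ := Finset.mem_filter.1 hj
    have hj3' : j < 3 := Finset.mem_range.1 hj3
    refine Finset.mem_filter.2 ⟨by simp only [dif_pos hj3']; exact hwR _, hη.trans (funext fun m => ?_)⟩
    simp only [dif_pos hj3']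
    rw [hc _ hj3', hcw]
  · intro i hi j hj h
    have hi3 : i < 3 := Finset.mem_range.1 (Finset.mem_filter.1 hi).1
    have hj3 : j < 3 := Finset.mem_range.1 (Finset.mem_filter.1 hj).1
    simp only [dif_pos hi3, dif_pos hj3] at h
    exact Fin.mk.inj_iff.1 (hwinj h)
  · intro v hv
    obtain ⟨hvR, hη⟩ := Finset.mem_filter.1 hv
    obtain ⟨j, hj⟩ := hsurj v
    have hvw : v = w j := hinjR v hvR (w j) (hwR j) (by rw [hj, hw])
    subst hvw
    refine ⟨j.1, Finset.mem_filter.2 ⟨Finset.mem_range.2 j.2, hη.trans (funext fun m => ?_)⟩, by simp only [dif_pos j.2]⟩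
    rw [hc _ j.2, hcw]

end General

/-! ## §4 THE HEAD: the exponents of `D(η,ψ)` in the `tch`-currency of ★ H0-a -/

set_option maxHeartbeats 400000 in
open scoped Classical in
/-- **BRICK GEO-QB — THE EXPONENTS OF THE STANDARD MODULE `D(η,ψ) = Ind_{P₂₁}((η∘det₂ ⊠ ψ)δ^{1∕2})` OF `GL₃(F)`, WITH MULTIPLICITY.**  For characters `η, ψ` of `F^×` with open kernels,
`D η ψ = parabolicIndGL F ![f,f,t] (𝟙.twist ψ_Q)` (★ STD-EMB) and `θ_D = (ην½⁻¹, ην½, ψ)`: the Borel Jacquet module `r_U(D η ψ)` is finite-dimensional and, for every `ζ : T → ℂ`,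
**`mult (D η ψ) ζ = #{w ∈ {1, s₂, s₁s₂} : ζ = tch (θ_D ∘ w⁻¹)}`** — i.e. `E(D η ψ) = {tch(ην½⁻¹,ην½,ψ), tch(ην½⁻¹,ψ,ην½), tch(ψ,ην½⁻¹,ην½)}`, each ONCE; in particular `dim r_U(D η ψ) = 3`.
(§3 with `σ′ = σ′_Q`, `χ = tch θ_D` via ★ (G3a) `inducingCharQ_apply_borel`, and ★ H0-a `tch_leviProjection_permGL_conj`: `tch θ_D ∘ Ad(P_w) = tch(θ_D ∘ w⁻¹)`.)  The architect's «honest extra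
input» of the case bricks C1′∕C2 (MEMO-SA-architecture v2 §3). [cite: BernsteinZelevinsky1977, §2.12, Thm. 5.2] [cite: Zelevinsky1980, §1.2, §1.6, Thm. 1.2] [cite: Casselman1995, §6.3, Thm. 6.3.5] -/
theorem finrank_weightSpace_normalizedJacquetGL_D (η ψ : Fˣ →* ℂˣ) (hη : IsOpen ((η.ker : Subgroup Fˣ) : Set Fˣ)) (hψ : IsOpen ((ψ.ker : Subgroup Fˣ) : Set Fˣ))
    (ζ : (Π a : Fin 3, GL {i : Fin 3 // (id : Fin 3 → Fin 3) i = a} F) → ℂ) :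
    FiniteDimensional ℂ (restrictUnipotentGL F (id : Fin 3 → Fin 3) (Representation.parabolicIndGL F (![false, false, true] : Fin 3 → Bool) ((Representation.trivial ℂ (Π a : Bool, GL {i : Fin 3 // (![false, false, true] : Fin 3 → Bool) i = a} F) ℂ).twist ((η.comp (Matrix.GeneralLinearGroup.det.comp (Pi.evalMonoidHom (fun a : Bool => GL {i : Fin 3 // (![false, false, true] : Fin 3 → Bool) i = a} F) false))) * (ψ.comp (Matrix.GeneralLinearGroup.det.comp (Pi.evalMonoidHom (fun a : Bool => GL {i : Fin 3 // (![false, false, true] : Fin 3 → Bool) i = a} F) true))))))).Coinvariants ∧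
    finrank ℂ ↥(⨅ m, Module.End.maxGenEigenspace (Representation.normalizedJacquetGL F (id : Fin 3 → Fin 3) (Representation.parabolicIndGL F (![false, false, true] : Fin 3 → Bool) ((Representation.trivial ℂ (Π a : Bool, GL {i : Fin 3 // (![false, false, true] : Fin 3 → Bool) i = a} F) ℂ).twist ((η.comp (Matrix.GeneralLinearGroup.det.comp (Pi.evalMonoidHom (fun a : Bool => GL {i : Fin 3 // (![false, false, true] : Fin 3 → Bool) i = a} F) false))) * (ψ.comp (Matrix.GeneralLinearGroup.det.comp (Pi.evalMonoidHom (fun a : Bool => GL {i : Fin 3 // (![false, false, true] : Fin 3 → Bool) i = a} F) true)))))) m) (ζ m)) =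
      (({1, Equiv.swap (1 : Fin 3) 2, Equiv.swap (0 : Fin 3) 1 * Equiv.swap (1 : Fin 3) 2} : Finset (Equiv.Perm (Fin 3))).filter fun w => ζ = fun m => (((∏ a : Fin 3, ((fun a => (![η * ((unramifiedTwist F (1 / 2) : QuasiChar F).toMonoidHom)⁻¹, η * ((unramifiedTwist F (1 / 2) : QuasiChar F).toMonoidHom), ψ] : Fin 3 → (Fˣ →* ℂˣ)) (w.symm a)) a).comp ((Matrix.GeneralLinearGroup.det : GL {i : Fin 3 // (id : Fin 3 → Fin 3) i = a} F →* Fˣ).comp (Pi.evalMonoidHom (fun b : Fin 3 => GL {i : Fin 3 // (id : Fin 3 → Fin 3) i = b} F) a))) m : ℂˣ) : ℂ)).card := by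
  obtain ⟨hfd, h⟩ := finrank_weightSpace_normalizedJacquetGL_smoothIndRep_twoOne (Representation.twist (((Representation.trivial ℂ (Π a : Bool, GL {i : Fin 3 // (![false, false, true] : Fin 3 → Bool) i = a} F) ℂ).twist ((η.comp (Matrix.GeneralLinearGroup.det.comp (Pi.evalMonoidHom (fun a : Bool => GL {i : Fin 3 // (![false, false, true] : Fin 3 → Bool) i = a} F) false))) * (ψ.comp (Matrix.GeneralLinearGroup.det.comp (Pi.evalMonoidHom (fun a : Bool => GL {i : Fin 3 // (![false, false, true] : Fin 3 → Bool) i = a} F) true))))).comp (leviProjection F (![false, false, true] : Fin 3 → Bool))) (rootDeltaChar (standardParabolicGL F (![false, false, true] : Fin 3 → Bool)))) (∏ a : Fin 3, (((![η * ((unramifiedTwist F (1 / 2) : QuasiChar F).toMonoidHom)⁻¹, η * ((unramifiedTwist F (1 / 2) : QuasiChar F).toMonoidHom), ψ] : Fin 3 → (Fˣ →* ℂˣ))) a).comp (Matrix.GeneralLinearGroup.det.comp (Pi.evalMonoidHom (fun a : Fin 3 => GL {i : Fin 3 // (id : Fin 3 → Fin 3) i = a} F) a)))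
    (isSmooth_inducingCharQ η ψ hη hψ) (fun g hg z => inducingCharQ_apply_borel η ψ hg z) ζ
  refine ⟨hfd, h.trans (congrArg Finset.card (Finset.filter_congr fun w _ => ?_))⟩
  have hw : (fun m : (Π a : Fin 3, GL {i : Fin 3 // (id : Fin 3 → Fin 3) i = a} F) => (((((∏ a : Fin 3, (((![η * ((unramifiedTwist F (1 / 2) : QuasiChar F).toMonoidHom)⁻¹, η * ((unramifiedTwist F (1 / 2) : QuasiChar F).toMonoidHom), ψ] : Fin 3 → (Fˣ →* ℂˣ))) a).comp (Matrix.GeneralLinearGroup.det.comp (Pi.evalMonoidHom (fun a : Fin 3 => GL {i : Fin 3 // (id : Fin 3 → Fin 3) i = a} F) a)))) (leviProjection F (id : Fin 3 → Fin 3) ⟨(permGL (w) : GL (Fin 3) F) * blockDiagonalGL F (id : Fin 3 → Fin 3) m * (permGL (w) : GL (Fin 3) F)⁻¹, permGL_conj_blockDiagonalGL_mem_borel w m⟩)) : ℂˣ) : ℂ)) =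
      fun m => (((∏ a : Fin 3, ((fun a => (![η * ((unramifiedTwist F (1 / 2) : QuasiChar F).toMonoidHom)⁻¹, η * ((unramifiedTwist F (1 / 2) : QuasiChar F).toMonoidHom), ψ] : Fin 3 → (Fˣ →* ℂˣ)) (w.symm a)) a).comp ((Matrix.GeneralLinearGroup.det : GL {i : Fin 3 // (id : Fin 3 → Fin 3) i = a} F →* Fˣ).comp (Pi.evalMonoidHom (fun b : Fin 3 => GL {i : Fin 3 // (id : Fin 3 → Fin 3) i = b} F) a))) m : ℂˣ) : ℂ) :=
    funext fun m => congrArg Units.val (K2E3GL3PrincipalSeriesExponents.tch_leviProjection_permGL_conj (![η * ((unramifiedTwist F (1 / 2) : QuasiChar F).toMonoidHom)⁻¹, η * ((unramifiedTwist F (1 / 2) : QuasiChar F).toMonoidHom), ψ] : Fin 3 → (Fˣ →* ℂˣ)) w m)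
  rw [hw]

/-- `r_U(D η ψ)` is finite-dimensional (the `FiniteDimensional` conjunct of `finrank_weightSpace_normalizedJacquetGL_D`, as an instance-shaped theorem for `haveI`).
[cite: BernsteinZelevinsky1977, §2.12, Thm. 5.2] -/
theorem finiteDimensional_jacquet_D (η ψ : Fˣ →* ℂˣ) (hη : IsOpen ((η.ker : Subgroup Fˣ) : Set Fˣ)) (hψ : IsOpen ((ψ.ker : Subgroup Fˣ) : Set Fˣ)) :
    FiniteDimensional ℂ (restrictUnipotentGL F (id : Fin 3 → Fin 3) (Representation.parabolicIndGL F (![false, false, true] : Fin 3 → Bool) ((Representation.trivial ℂ (Π a : Bool, GL {i : Fin 3 // (![false, false, true] : Fin 3 → Bool) i = a} F) ℂ).twist ((η.comp (Matrix.GeneralLinearGroup.det.comp (Pi.evalMonoidHom (fun a : Bool => GL {i : Fin 3 // (![false, false, true] : Fin 3 → Bool) i = a} F) false))) * (ψ.comp (Matrix.GeneralLinearGroup.det.comp (Pi.evalMonoidHom (fun a : Bool => GL {i : Fin 3 // (![false, false, true] : Fin 3 → Bool) i = a} F) true))))))).Coinvariants :=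
  (finrank_weightSpace_normalizedJacquetGL_D η ψ hη hψ fun _ => 0).1

set_option maxHeartbeats 400000 in
open scoped Classical in
/-- **THE EXPONENT TABLE OF `D(η,ψ)` AS A SUM OF THREE INDICATORS** (the shape the case bricks C2∕C1′ read, K2E3-p11 (g7) bus 11:42:24Z): for every `ζ : T → ℂ`,
`mult (D η ψ) ζ = [ζ = tch(ην½⁻¹, ην½, ψ)] + [ζ = tch(ην½⁻¹, ψ, ην½)] + [ζ = tch(ψ, ην½⁻¹, ην½)]`, the three weights written as PLAIN triples (`θ_D ∘ 1⁻¹`, `θ_D ∘ s₂⁻¹`, `θ_D ∘ (s₁s₂)⁻¹`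
evaluated by `fin_cases`) in the `tch`-spelling of ★ STD-EMB ∕ ★ H0-a.  No distinctness of the three weights is needed or claimed.
[cite: BernsteinZelevinsky1977, §2.12, Thm. 5.2] [cite: Zelevinsky1980, §1.2, §1.6, Thm. 1.2] -/
theorem finrank_weightSpace_D_eq (η ψ : Fˣ →* ℂˣ) (hη : IsOpen ((η.ker : Subgroup Fˣ) : Set Fˣ)) (hψ : IsOpen ((ψ.ker : Subgroup Fˣ) : Set Fˣ))
    (ζ : (Π a : Fin 3, GL {i : Fin 3 // (id : Fin 3 → Fin 3) i = a} F) → ℂ) :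
    finrank ℂ ↥(⨅ m, Module.End.maxGenEigenspace (Representation.normalizedJacquetGL F (id : Fin 3 → Fin 3) (Representation.parabolicIndGL F (![false, false, true] : Fin 3 → Bool) ((Representation.trivial ℂ (Π a : Bool, GL {i : Fin 3 // (![false, false, true] : Fin 3 → Bool) i = a} F) ℂ).twist ((η.comp (Matrix.GeneralLinearGroup.det.comp (Pi.evalMonoidHom (fun a : Bool => GL {i : Fin 3 // (![false, false, true] : Fin 3 → Bool) i = a} F) false))) * (ψ.comp (Matrix.GeneralLinearGroup.det.comp (Pi.evalMonoidHom (fun a : Bool => GL {i : Fin 3 // (![false, false, true] : Fin 3 → Bool) i = a} F) true)))))) m) (ζ m)) =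
      (if ζ = fun m => (((∏ a : Fin 3, ((![η * ((unramifiedTwist F (1 / 2) : QuasiChar F).toMonoidHom)⁻¹, η * ((unramifiedTwist F (1 / 2) : QuasiChar F).toMonoidHom), ψ] : Fin 3 → (Fˣ →* ℂˣ)) a).comp (Matrix.GeneralLinearGroup.det.comp (Pi.evalMonoidHom (fun a : Fin 3 => GL {i : Fin 3 // (id : Fin 3 → Fin 3) i = a} F) a))) m : ℂˣ) : ℂ) then 1 else 0) +
      (if ζ = fun m => (((∏ a : Fin 3, ((![η * ((unramifiedTwist F (1 / 2) : QuasiChar F).toMonoidHom)⁻¹, ψ, η * ((unramifiedTwist F (1 / 2) : QuasiChar F).toMonoidHom)] : Fin 3 → (Fˣ →* ℂˣ)) a).comp (Matrix.GeneralLinearGroup.det.comp (Pi.evalMonoidHom (fun a : Fin 3 => GL {i : Fin 3 // (id : Fin 3 → Fin 3) i = a} F) a))) m : ℂˣ) : ℂ) then 1 else 0) +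
      (if ζ = fun m => (((∏ a : Fin 3, ((![ψ, η * ((unramifiedTwist F (1 / 2) : QuasiChar F).toMonoidHom)⁻¹, η * ((unramifiedTwist F (1 / 2) : QuasiChar F).toMonoidHom)] : Fin 3 → (Fˣ →* ℂˣ)) a).comp (Matrix.GeneralLinearGroup.det.comp (Pi.evalMonoidHom (fun a : Fin 3 => GL {i : Fin 3 // (id : Fin 3 → Fin 3) i = a} F) a))) m : ℂˣ) : ℂ) then 1 else 0) := by
  obtain ⟨-, h⟩ := finrank_weightSpace_normalizedJacquetGL_D η ψ hη hψ ζ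
  have e1 : (fun a => (![η * ((unramifiedTwist F (1 / 2) : QuasiChar F).toMonoidHom)⁻¹, η * ((unramifiedTwist F (1 / 2) : QuasiChar F).toMonoidHom), ψ] : Fin 3 → (Fˣ →* ℂˣ)) ((1 : Equiv.Perm (Fin 3)).symm a)) = (![η * ((unramifiedTwist F (1 / 2) : QuasiChar F).toMonoidHom)⁻¹, η * ((unramifiedTwist F (1 / 2) : QuasiChar F).toMonoidHom), ψ] : Fin 3 → (Fˣ →* ℂˣ)) := funext fun a => by fin_cases a <;> rfl
  have e2 : (fun a => (![η * ((unramifiedTwist F (1 / 2) : QuasiChar F).toMonoidHom)⁻¹, η * ((unramifiedTwist F (1 / 2) : QuasiChar F).toMonoidHom), ψ] : Fin 3 → (Fˣ →* ℂˣ)) ((Equiv.swap (1 : Fin 3) 2).symm a)) = (![η * ((unramifiedTwist F (1 / 2) : QuasiChar F).toMonoidHom)⁻¹, ψ, η * ((unramifiedTwist F (1 / 2) : QuasiChar F).toMonoidHom)] : Fin 3 → (Fˣ →* ℂˣ)) := funext fun a => by fin_cases a <;> rfl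
  have e3 : (fun a => (![η * ((unramifiedTwist F (1 / 2) : QuasiChar F).toMonoidHom)⁻¹, η * ((unramifiedTwist F (1 / 2) : QuasiChar F).toMonoidHom), ψ] : Fin 3 → (Fˣ →* ℂˣ)) ((Equiv.swap (0 : Fin 3) 1 * Equiv.swap (1 : Fin 3) 2).symm a)) = (![ψ, η * ((unramifiedTwist F (1 / 2) : QuasiChar F).toMonoidHom)⁻¹, η * ((unramifiedTwist F (1 / 2) : QuasiChar F).toMonoidHom)] : Fin 3 → (Fˣ →* ℂˣ)) := funext fun a => by fin_cases a <;> rfl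
  have h12 : (1 : Equiv.Perm (Fin 3)) ∉ ({Equiv.swap (1 : Fin 3) 2, Equiv.swap (0 : Fin 3) 1 * Equiv.swap (1 : Fin 3) 2} : Finset (Equiv.Perm (Fin 3))) := by decide
  have h23 : Equiv.swap (1 : Fin 3) 2 ∉ ({Equiv.swap (0 : Fin 3) 1 * Equiv.swap (1 : Fin 3) 2} : Finset (Equiv.Perm (Fin 3))) := by decide
  rw [h, Finset.card_filter, Finset.sum_insert h12, Finset.sum_insert h23, Finset.sum_singleton, e1, e2, e3, add_assoc]

/-- `θ_D ∘ 1⁻¹ = θ_D = (ην½⁻¹, ην½, ψ)`. [cite: BernsteinZelevinsky1977, §2.12] -/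
theorem theta_comp_one_symm (η ψ : Fˣ →* ℂˣ) : (fun a => (![η * ((unramifiedTwist F (1 / 2) : QuasiChar F).toMonoidHom)⁻¹, η * ((unramifiedTwist F (1 / 2) : QuasiChar F).toMonoidHom), ψ] : Fin 3 → (Fˣ →* ℂˣ)) ((1 : Equiv.Perm (Fin 3)).symm a)) = (![η * ((unramifiedTwist F (1 / 2) : QuasiChar F).toMonoidHom)⁻¹, η * ((unramifiedTwist F (1 / 2) : QuasiChar F).toMonoidHom), ψ] : Fin 3 → (Fˣ →* ℂˣ)) := rfl

/-- `θ_D ∘ s₂⁻¹ = (ην½⁻¹, ψ, ην½)`. [cite: BernsteinZelevinsky1977, §2.12] -/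
theorem theta_comp_swap_one_two_symm (η ψ : Fˣ →* ℂˣ) : (fun a => (![η * ((unramifiedTwist F (1 / 2) : QuasiChar F).toMonoidHom)⁻¹, η * ((unramifiedTwist F (1 / 2) : QuasiChar F).toMonoidHom), ψ] : Fin 3 → (Fˣ →* ℂˣ)) ((Equiv.swap (1 : Fin 3) 2).symm a)) = (![η * ((unramifiedTwist F (1 / 2) : QuasiChar F).toMonoidHom)⁻¹, ψ, η * ((unramifiedTwist F (1 / 2) : QuasiChar F).toMonoidHom)] : Fin 3 → (Fˣ →* ℂˣ)) := by
  funext a; fin_cases a <;> rfl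

/-- `θ_D ∘ (s₁s₂)⁻¹ = (ψ, ην½⁻¹, ην½)`. [cite: BernsteinZelevinsky1977, §2.12] -/
theorem theta_comp_cycle_one_two_zero_symm (η ψ : Fˣ →* ℂˣ) : (fun a => (![η * ((unramifiedTwist F (1 / 2) : QuasiChar F).toMonoidHom)⁻¹, η * ((unramifiedTwist F (1 / 2) : QuasiChar F).toMonoidHom), ψ] : Fin 3 → (Fˣ →* ℂˣ)) ((Equiv.swap (0 : Fin 3) 1 * Equiv.swap (1 : Fin 3) 2).symm a)) = (![ψ, η * ((unramifiedTwist F (1 / 2) : QuasiChar F).toMonoidHom)⁻¹, η * ((unramifiedTwist F (1 / 2) : QuasiChar F).toMonoidHom)] : Fin 3 → (Fˣ →* ℂˣ)) := by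
  funext a; fin_cases a <;> rfl


end Summit.HodgeConjecture.HodgeConjecture.Cruxes.H413.K2E3GL3StandardModuleJacquetDimension

end
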